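import Summits.QuantumFields.BalabanUV.Beta.FP.NestedDressingProjector

/-!
# `BalabanUV.Beta.FP.NestedDressingProjectorCovariance` — road «FP» for binder row D1, R-FP-45 (B), row NESTED-DRESS, FILE 5: THE NESTED PROJECTOR COMMUTES WITH
# EVERY AXIS PERMUTATION (centred root) AND EVERY CENTRED AXIS REFLECTION (`Lc` odd) — the m-fold twins of an2's S1f `symAxProjBmAt_ctr_P1` ∕ `symAxProjBmAt_R1`,
# so the symmetry class of the literal (row N3's hypotheses on the dressed objects) is inherited by the nested-dressed (j, m)-families

HONEST DEPENDENCY (page 1, mandatory): continuum YM on T⁴ ⇐ BetaPertH ∧ nine spine estimates (0/9 proved); BetaPertH ⇐ (D1) ∧ (D4) ∧ CAP+tail;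
G-an2-4 gates asym, D1 and NE2/3/4.  HONEST FRAMING (cell contract, verbatim): «discharging `BetaPertH` makes Bałaban's UV stability UNCONDITIONAL —
a real constructive-QFT result; it is NOT the continuum limit and NOT the Clay problem.»  THIS MODULE DISCHARGES NOTHING of the wall: [folklore] finite sums on
`ℤ^d` (generic `d`; CENTRED root `ctr d Lc`; `Odd Lc` for the reflections).  No `def`, no `def … : Prop`, nothing cited, 0 sorry; 0∕4 row-D1 binders; NOT SDF,
NOT D1, NOT BetaPertH, NOT continuum, NOT Clay.  «not in print; our bookkeeping».

ABSOLUTE RULE (cell charter, verbatim): «No internally-minted statement may enter as a cited fact. Every hypothesis is either kernel-proved in this package or a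
verbatim quotation of a PUBLISHED theorem with page reference. The manuscript(s) under audit are NOT citable for their own disputed steps — they are the thing
under adjudication; programme-internal (2001/route/tribunal) claims are never citable.»

WHY.  R-FP-45 (B) replaces, for m ≥ 2, the one-step dressing `Π̂₁` of the (j, m)-families by `Π^{(m)}_nest` (FILE 1).  Every symmetry argument of the road
(row N3: Ward ∕ axis-permutation ∕ centred-reflection class of the perfect objects; an2's `permK_piKSymBm`, `SymmetrisedDressingReflection`) enters through the
covariance of the dressing projector.  The nested functional is built from the literal's `σ₁` (covariant: an2 `symGaugeAt_ctr_P1` ∕ `symGaugeAt_R1`), the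
straight averaging (covariant: `contourSum_P1` ∕ `contourSum_R1`) and the block-label lift (covariant: `blk_psite` ∕ `blk_sref`), with the SAME centred root at
every level — so the covariance is an induction on `m`.

CONTENTS ([folklore]): §1 permutations — `qbar_P1`, `liftBlk_P0`, `symBmGaugeAt_ctr_P1`, **`symNestGaugeAt_ctr_P1`** (`σ^{(m)} (P1 π A) = P0 π (σ^{(m)} A)`),
**`symAxProjNestAt_ctr_P1`** (`Π^{(m)} (P1 π A) = P1 π (Π^{(m)} A)`); §2 centred reflections, `Odd Lc` — `qbar_R1`, `liftBlk_R0`, `symBmGaugeAt_R1`, **`symNestGaugeAt_R1`**,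
**`symAxProjNestAt_R1`**.
Provenance: road FP swarm LEAF PROVER `b2b-balaban-beta-d1-formalise-leaf-06` gen 14, 2026-08-21, row NESTED-DRESS.  Names PROVISIONAL.
-/

namespace Summit.QuantumFields.BalabanUV.Beta.FP.NestedDressingProjectorCovariance

noncomputable section

open Finset
open scoped BigOperators Nat
open Literature.MathematicalPhysics.QuantumFieldTheory.Balaban1983to89.Beta
open AffineAveraging (Form0 Form1 Site unitVec dz box toSite blockSum contourSum)
open AveragingContours (grad blk)
open AveragingContoursRooted (ctr)
open ResolventReflection (sref R0 R1 R0_apply R1_apply contourSum_R1)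
open RootedComb (blk_sref R1_sub grad_R0)
open Summit.QuantumFields.BalabanUV.Beta.KernelPermutation (psite psite_apply)
open Summit.QuantumFields.BalabanUV.Beta.ResolventPermutation (P0 P1 P0_apply P1_apply contourSum_P1)
open Summit.QuantumFields.BalabanUV.Beta.AxialProjectorBlockMean (blockMeanAt)
open Summit.QuantumFields.BalabanUV.Beta.SymmetrisedAxialPotential (blk_psite P1_grad)
open Summit.QuantumFields.BalabanUV.Beta.SymmetrisedAxialGauge (P1_sub)
open Summit.QuantumFields.BalabanUV.Beta.SymmetrisedAxialGaugeBlockMean (symGaugeAt symBmGaugeAt symAxProjBmAt blockMeanAt_P0 blockMeanAt_R0 symGaugeAt_ctr_P1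
  symGaugeAt_R1)
open Summit.QuantumFields.BalabanUV.Beta.FP.NestedDressingProjector (qbar liftBlk symNestGaugeAt symAxProjNestAt symNestGaugeAt_zero_left symNestGaugeAt_succ)

variable {d : ℕ}

/-! ## §1 Axis permutations (centred root) -/

/-- [folklore] The mean-normalised straight averaging commutes with the axis permutations (`contourSum_P1`). -/
theorem qbar_P1 (π : Equiv.Perm (Fin d)) (L : ℕ) (A : Form1 d ℝ) : qbar L (P1 π A) = P1 π (qbar L A) := by
  funext κ y
  simp only [qbar, P1_apply, contourSum_P1]

/-- [folklore] The block-label lift commutes with the axis permutations (`blk_psite`). -/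
theorem liftBlk_P0 (π : Equiv.Perm (Fin d)) (L : ℕ) (ψ : Form0 d ℝ) : liftBlk L (P0 π ψ) = P0 π (liftBlk L ψ) := by
  funext x
  simp only [liftBlk, P0_apply, blk_psite]

/-- [folklore] The literal's one-step functional at the centred root is a permutation scalar: `σ₁ (P1 π A) = P0 π (σ₁ A)`. -/
theorem symBmGaugeAt_ctr_P1 (π : Equiv.Perm (Fin d)) (N : ℕ) (A : Form1 d ℝ) :
    symBmGaugeAt (ctr d N) (P1 π A) N = P0 π (symBmGaugeAt (ctr d N) A N) := by
  unfold symBmGaugeAt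
  rw [symGaugeAt_ctr_P1, blockMeanAt_P0]
  rfl

/-- [folklore] **THE NESTED FUNCTIONAL AT THE CENTRED ROOT IS A PERMUTATION SCALAR**: `σ^{(m)} (P1 π A) = P0 π (σ^{(m)} A)`. -/
theorem symNestGaugeAt_ctr_P1 (π : Equiv.Perm (Fin d)) (Lc : ℕ) : ∀ (m : ℕ) (A : Form1 d ℝ),
    symNestGaugeAt (ctr d Lc) Lc m (P1 π A) = P0 π (symNestGaugeAt (ctr d Lc) Lc m A)
  | 0, A => by rw [symNestGaugeAt_zero_left, symNestGaugeAt_zero_left]; rfl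
  | m + 1, A => by
      rw [symNestGaugeAt_succ, symNestGaugeAt_succ, symBmGaugeAt_ctr_P1, qbar_P1, symNestGaugeAt_ctr_P1 π Lc m, liftBlk_P0]
      rfl

/-- [folklore] **`Π^{(m)}_nest` COMMUTES WITH EVERY AXIS PERMUTATION** (centred root): `Π^{(m)} (P1 π A) = P1 π (Π^{(m)} A)`. -/
theorem symAxProjNestAt_ctr_P1 (π : Equiv.Perm (Fin d)) (Lc m : ℕ) (A : Form1 d ℝ) :
    symAxProjNestAt (ctr d Lc) Lc m (P1 π A) = P1 π (symAxProjNestAt (ctr d Lc) Lc m A) := by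
  unfold symAxProjNestAt
  rw [symNestGaugeAt_ctr_P1, ← P1_grad, P1_sub]

/-! ## §2 Centred axis reflections (`Lc` odd) -/

/-- [folklore] The mean-normalised straight averaging commutes with the axis reflections (`contourSum_R1`). -/
theorem qbar_R1 (α : Fin d) (L : ℕ) (A : Form1 d ℝ) : qbar L (R1 α A) = R1 α (qbar L A) := by
  funext κ y
  simp only [qbar, R1_apply, contourSum_R1]
  ring

/-- [folklore] The block-label lift commutes with the axis reflections (`blk_sref`, `L ≥ 1`). -/
theorem liftBlk_R0 {L : ℕ} (hL : 1 ≤ L) (α : Fin d) (ψ : Form0 d ℝ) : liftBlk L (R0 α ψ) = R0 α (liftBlk L ψ) := by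
  funext x
  simp only [liftBlk, R0_apply, blk_sref hL]

/-- [folklore] The literal's one-step functional at the centred root is a reflection scalar (`N` odd): `σ₁ (R1 α A) = R0 α (σ₁ A)`. -/
theorem symBmGaugeAt_R1 {N : ℕ} (hN : Odd N) (α : Fin d) (A : Form1 d ℝ) :
    symBmGaugeAt (ctr d N) (R1 α A) N = R0 α (symBmGaugeAt (ctr d N) A N) := by
  unfold symBmGaugeAt
  rw [symGaugeAt_R1 hN, blockMeanAt_R0 hN.pos]
  rfl

/-- [folklore] **THE NESTED FUNCTIONAL AT THE CENTRED ROOT IS A REFLECTION SCALAR** (`Lc` odd): `σ^{(m)} (R1 α A) = R0 α (σ^{(m)} A)`. -/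
theorem symNestGaugeAt_R1 {Lc : ℕ} (hLc : Odd Lc) (α : Fin d) : ∀ (m : ℕ) (A : Form1 d ℝ),
    symNestGaugeAt (ctr d Lc) Lc m (R1 α A) = R0 α (symNestGaugeAt (ctr d Lc) Lc m A)
  | 0, A => by rw [symNestGaugeAt_zero_left, symNestGaugeAt_zero_left]; rfl
  | m + 1, A => by
      rw [symNestGaugeAt_succ, symNestGaugeAt_succ, symBmGaugeAt_R1 hLc, qbar_R1, symNestGaugeAt_R1 hLc α m, liftBlk_R0 hLc.pos]
      rfl

/-- [folklore] **`Π^{(m)}_nest` COMMUTES WITH EVERY CENTRED AXIS REFLECTION** (`Lc` odd): `Π^{(m)} (R1 α A) = R1 α (Π^{(m)} A)`. -/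
theorem symAxProjNestAt_R1 {Lc : ℕ} (hLc : Odd Lc) (α : Fin d) (m : ℕ) (A : Form1 d ℝ) :
    symAxProjNestAt (ctr d Lc) Lc m (R1 α A) = R1 α (symAxProjNestAt (ctr d Lc) Lc m A) := by
  unfold symAxProjNestAt
  rw [symNestGaugeAt_R1 hLc, grad_R0, R1_sub]

end

end Summit.QuantumFields.BalabanUV.Beta.FP.NestedDressingProjectorCovariance
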